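import Summits.QuantumFields.YangMills.Theorems.BalabanUVNodesN15KingModelFreeRGGaussNorm
import Summits.QuantumFields.YangMills.Theorems.BalabanUVNodesN15KingModelBlockFieldDeterminantRate
import Summits.QuantumFields.YangMills.Theorems.BalabanUVNodesN15KingModelBlockFieldMeasureContinuumLimit
import Literature.MathematicalPhysics.QuantumFieldTheory.Balaban1983to89.Beta.GaussianIntegral
import Literature.MathematicalPhysics.QuantumFieldTheory.Balaban1983to89.NodeOGamma0Road
import HarnessLib

/-!
# BalabanUVNodes ∕ N15 — THE KING-MODEL RUNG (PART Ε-p): THE GAUSSIAN NORMALISATION OF PART Τ IS A DETERMINANT — `𝒩(Δ) = √(2π)^{|ι|}∕√det Δ` FOR EVERY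
# SYMMETRIC COERCIVE `Δ` — HENCE KING's (3.89) LITERALLY («ln N_K = −½ ln det Δ^{(K)} + const») FOR HIS THREE FREE LAPLACIANS, AND (3.93)'s RATE FOR THE
# NORMALISATIONS THEMSELVES `|ln N_K − ln N_∞| ≤ ½|Ω|·C·L^{−2K}`
# (Track A, DAG node N15 = NE2; FAN-OUT v1.1 §N15 s3 «KING-MODEL RUNG»; joins part Τ-a (determinant-free `gaussNorm`) to parts Ε-k∕Ε-n∕Ε-o; count-neutral)

HONEST FRAMING.  Count-neutral (cell `pub-ymgap`, seat `pub-ymgap-dag-n15-e` g40; `--supports stmt-QuantumFields-27366 --as helper` = K3⁸).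
TEMPLATE LITERATURE: C. King, Commun. Math. Phys. **102** (1986) 649–677 [King1986], (2.6) p.652 (`exp E₀ = ∫dμ e^{−½⟨…⟩}`), (2.15) p.653 (`N`), (3.89) p.668 («ln N_k =
−½ ln det Δ^{(k)} + const»), (3.93) p.669 («|ln N_k − ln N_{k+n}| ≤ … ≤ CL^{−2k}·#sites»), (4.4)–(4.5) p.670.  Part Τ-a typed the Gaussian normalisation `gaussNorm Δ =
∫_{ℝ^ι} e^{−½⟨x,Δx⟩}dx` and its comparison theory WITHOUT determinants («NO closed form (determinant) is used anywhere in part Τ»); the tree's BETA cell holds the closed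
form for POSITIVE DEFINITE matrices (`Beta.GaussianIntegral.integral_exp_neg_half_quadForm`: `∫e^{−½vᵀAv}dv = √(2π)^{|ι|}∕√det A`, with its `log` form); parts Ε-k∕Ε-n∕Ε-o
computed the determinants of King's three free Laplacians (`lapF`, `Δ^{(K)}`, `Δ^{(∞)}`) by plane waves.  THIS FILE only JOINS them: §1 ★★ **`gaussNorm_eq_det`** ∕
**`log_gaussNorm_eq`** — for a real SYMMETRIC matrix COERCIVE with a constant `δ > 0` (part Τ's standing hypotheses; `PosDef` via pv `NodeOGamma0Road.posDef_of_coercive_symm`),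
`gaussNorm Δ = √(2π)^{|ι|}∕√det Δ` and `ln 𝒩(Δ) = ½|ι|ln 2π − ½ln det Δ`.  §2 KING's (3.89) LITERALLY in the free model: ★★ **`log_gaussNorm_lapF`** (fine field on any torus:
`ln 𝒩(c(−Δ)+m²) = ½|T|ln 2π − ½Σ_q ln lapSym(q)`), ★★★ **`log_gaussNorm_effLaplacian`** (block field: `ln N_K := ln 𝒩(Δ^{(K)}) = ½|Ω|ln 2π − ½Σ_{q∈Ω̂} ln effSym(q)`, every
`N ≥ 1`, `a > 0`, `c ≥ 0`, `m² > 0`), `gaussNorm_effLaplacian_eq` (`N_K = √(2π)^{|Ω|}∕√(Π_q effSym(q))`), ★★ **`log_gaussNorm_effLaplacianLim`** (`ln N_∞ = ½|Ω|ln 2π −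
½Σ_q ln Δ^{(∞)}(p′(q))`).  §3 ★★★ **`abs_log_gaussNorm_effLaplacian_sub_lim_le`** — KING's (3.93) FOR THE NORMALISATIONS THEMSELVES: `|ln N_K − ln N_∞| ≤
½|Ω|·((a_∞⁻¹+m⁻²)·C_Δ(a))·L^{−2K}` (`K ≥ 1`, `L` odd `≥ 2`, every unit torus; part Ε-o's determinant rate), sharpening part Ϡ-k's rate-free `tendsto_gaussNorm_effLaplacian`;
per site ★★ **`abs_log_gaussNorm_div_card_sub_lim_le`**.

PRIOR TREE ART (used, not restated): part Τ-a (`gaussNorm`), BETA cell `Beta.GaussianIntegral` (`integral_exp_neg_half_quadForm`, `log_integral_exp_neg_half_quadForm`),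
pv `NodeOGamma0Road.posDef_of_coercive_symm`, parts Ε-k (`log_det_lapF`), Ε-n (`log_det_effLaplacian`, `det_effLaplacian_eq_prod_effSym`), Ε-o (`log_det_effLaplacianLim`,
`abs_log_det_effLaplacian_sub_lim_le`), part Ϡ-g (`effLaplacian_transpose_eq`), part Ϡ-k (`effLaplacianLim_transpose_eq`, `coercive_effLaplacianLim`), `King1986` (`lapF_coercive`,
`lapF_comm`, `effLaplacian_coercive_of_nonneg`), pv17 `QGQInverse.Coercive`.  NOT Bałaban's covariant objects; NOT a node discharge (N15 is booked through n15-a's knit, untouched);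
nothing continuum-YM ∕ `ℝ⁴` ∕ OS ∕ Clay.  0 `sorry`, 0 `def`.

HONEST SCOPE.  §1 is finite-dimensional real analysis (any finite index type), a two-line join of existing tree lemmas; §2–§3 are King's `A = 0` free model on unit tori
(dimension `d+1`), scales `N = L^K`.  The additive constant `½|ι|ln 2π` is the Lebesgue one (King absorbs such constants into `E₀`).  Locators: [King1986] (2.6) p.652, (2.15)
p.653, (3.89) p.668, (3.93) p.669, (4.4)–(4.5) p.670.
-/

noncomputable section

open scoped BigOperators Topology
open Finset Filter Matrix MeasureTheory

namespace Summit.QuantumFields.YangMills.BalabanUVNodes.N15KingModelRung.TorusSpectral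

open Literature.MathematicalPhysics.QuantumFieldTheory.Balaban1983to89.QGQInverse (Coercive)
open Literature.MathematicalPhysics.QuantumFieldTheory.Balaban1983to89.B5Prop11Plancherel (Tor sOf)
open Literature.MathematicalPhysics.QuantumFieldTheory.Balaban1983to89.NodeOGamma0Road (posDef_of_coercive_symm)
open Literature.MathematicalPhysics.QuantumFieldTheory.Balaban1983to89.Beta.GaussianIntegral (integral_exp_neg_half_quadForm log_integral_exp_neg_half_quadForm)
open Literature.MathematicalPhysics.QuantumFieldTheory.King1986 (aK aK_pos)
open Literature.MathematicalPhysics.QuantumFieldTheory.King1986.Torus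
open Summit.QuantumFields.YangMills.BalabanUVNodes.N15KingModelRung.FreeField (gaussNorm)

/-! ## §1 Part Τ's Gaussian normalisation of a symmetric coercive matrix is `√(2π)^n ∕ √det` -/

section Generic

variable {ι : Type*} [Fintype ι] [DecidableEq ι]

/-- ★★ **PART Τ's NORMALISATION IS A DETERMINANT**: for every real symmetric `Δ` coercive with a constant `δ > 0`, `𝒩(Δ) = ∫_{ℝ^ι} e^{−½⟨x,Δx⟩}dx = √(2π)^{|ι|} ∕ √(det Δ)`
(the BETA cell's closed form read through part Τ-a's `gaussNorm`). [cite: King1986, (2.6) p.652, (3.89) p.668] -/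
theorem gaussNorm_eq_det {Δ : Matrix ι ι ℝ} (hsymm : Δᵀ = Δ) {δ : ℝ} (hδ : 0 < δ) (hΔ : Coercive Δ δ) :
    gaussNorm Δ = Real.sqrt (2 * Real.pi) ^ Fintype.card ι / Real.sqrt Δ.det :=
  integral_exp_neg_half_quadForm Δ (posDef_of_coercive_symm hsymm hδ hΔ)

/-- `det Δ > 0` for symmetric coercive `Δ`. [folklore] -/
theorem det_pos_of_coercive {Δ : Matrix ι ι ℝ} (hsymm : Δᵀ = Δ) {δ : ℝ} (hδ : 0 < δ) (hΔ : Coercive Δ δ) : 0 < Δ.det :=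
  (posDef_of_coercive_symm hsymm hδ hΔ).det_pos

/-- ★★ **`ln 𝒩(Δ) = ½|ι|·ln 2π − ½·ln det Δ`** (King's «ln N = −½ ln det Δ + const»). [cite: King1986, (3.89) p.668, (2.6) p.652] -/
theorem log_gaussNorm_eq {Δ : Matrix ι ι ℝ} (hsymm : Δᵀ = Δ) {δ : ℝ} (hδ : 0 < δ) (hΔ : Coercive Δ δ) :
    Real.log (gaussNorm Δ) = (Fintype.card ι : ℝ) / 2 * Real.log (2 * Real.pi) - 1 / 2 * Real.log Δ.det :=
  log_integral_exp_neg_half_quadForm Δ (posDef_of_coercive_symm hsymm hδ hΔ)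

end Generic

/-! ## §2 King's (3.89) literally, in the free model -/

section King

variable {d : ℕ}

/-- ★★ **THE FINE-FIELD NORMALISATION ON ANY TORUS**: `ln 𝒩(c(−Δ)+m²) = ½|T|·ln 2π − ½Σ_{q∈T̂} ln lapSym(q)` (`c ≥ 0`, `m² > 0`; part Ε-k's determinant).
[cite: King1986, (2.6) p.652, (3.89) p.668, (4.4) p.670] -/
theorem log_gaussNorm_lapF (K : Fin (d + 1) → ℕ) [∀ μ, NeZero (K μ)] {c m2 : ℝ} (hc : 0 ≤ c) (hm : 0 < m2) :
    Real.log (gaussNorm (lapF K c m2)) = (Fintype.card (Tor K) : ℝ) / 2 * Real.log (2 * Real.pi) - 1 / 2 * ∑ q : Tor K, Real.log (lapSym K c m2 q) := by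
  have hsymm : (lapF K c m2)ᵀ = lapF K c m2 := by
    ext z z'
    rw [Matrix.transpose_apply]
    exact lapF_comm K c m2 z z'
  rw [log_gaussNorm_eq hsymm hm (lapF_coercive K c m2 hc), log_det_lapF K hc hm]

/-- `𝒩(c(−Δ)+m²) = √(2π)^{|T|} ∕ √(Π_q lapSym(q))`. [cite: King1986, (2.6) p.652, (4.4) p.670] -/
theorem gaussNorm_lapF_eq (K : Fin (d + 1) → ℕ) [∀ μ, NeZero (K μ)] {c m2 : ℝ} (hc : 0 ≤ c) (hm : 0 < m2) :
    gaussNorm (lapF K c m2) = Real.sqrt (2 * Real.pi) ^ Fintype.card (Tor K) / Real.sqrt (∏ q : Tor K, lapSym K c m2 q) := by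
  have hsymm : (lapF K c m2)ᵀ = lapF K c m2 := by
    ext z z'
    rw [Matrix.transpose_apply]
    exact lapF_comm K c m2 z z'
  rw [gaussNorm_eq_det hsymm hm (lapF_coercive K c m2 hc), det_lapF_eq_prod_lapSym K c m2]

/-- ★★★ **KING's (3.89) LITERALLY — THE BLOCK-FIELD NORMALISATION**: `ln N_K := ln 𝒩(Δ^{(K)}) = ½|Ω|·ln 2π − ½Σ_{q∈Ω̂} ln effSym(q)` for King's effective Laplacian
`Δ^{(K)} = effLaplacian N M a c m²` (every `N ≥ 1`, `a > 0`, `c ≥ 0`, `m² > 0`, every unit torus; part Ε-n's determinant). [cite: King1986, (3.89) p.668, (2.6) p.652, (2.14)–(2.15)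
p.653, (4.5) p.670] -/
theorem log_gaussNorm_effLaplacian (N : ℕ) [NeZero N] (M : Fin (d + 1) → ℕ) [∀ μ, NeZero (M μ)] {a c m2 : ℝ} (ha : 0 < a) (hc : 0 ≤ c) (hm : 0 < m2) :
    Real.log (gaussNorm (effLaplacian N M a c m2))
      = (Fintype.card (Tor M) : ℝ) / 2 * Real.log (2 * Real.pi) - 1 / 2 * ∑ q : Tor M, Real.log (effSym N M a c m2 q) := by
  rw [log_gaussNorm_eq (effLaplacian_transpose_eq N M a c m2) (by positivity : (0 : ℝ) < (a⁻¹ + m2⁻¹)⁻¹) (effLaplacian_coercive_of_nonneg N M ha hc hm),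
    log_det_effLaplacian N M ha hc hm]

/-- `N_K = 𝒩(Δ^{(K)}) = √(2π)^{|Ω|} ∕ √(Π_{q∈Ω̂} effSym(q))`. [cite: King1986, (2.15) p.653, (3.89) p.668, (4.5) p.670] -/
theorem gaussNorm_effLaplacian_eq (N : ℕ) [NeZero N] (M : Fin (d + 1) → ℕ) [∀ μ, NeZero (M μ)] {a c m2 : ℝ} (ha : 0 < a) (hc : 0 ≤ c) (hm : 0 < m2) :
    gaussNorm (effLaplacian N M a c m2) = Real.sqrt (2 * Real.pi) ^ Fintype.card (Tor M) / Real.sqrt (∏ q : Tor M, effSym N M a c m2 q) := by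
  rw [gaussNorm_eq_det (effLaplacian_transpose_eq N M a c m2) (by positivity : (0 : ℝ) < (a⁻¹ + m2⁻¹)⁻¹) (effLaplacian_coercive_of_nonneg N M ha hc hm),
    det_effLaplacian_eq_prod_effSym N M ha.le hc hm]

/-- ★★ **THE CONTINUUM NORMALISATION**: `ln N_∞ := ln 𝒩(Δ^{(∞)}) = ½|Ω|·ln 2π − ½Σ_{q∈Ω̂} ln Δ^{(∞)}(p′(q))` (`L` odd `≥ 2`, `a, m² > 0`; part Ε-o's determinant).
[cite: King1986, (3.89) p.668, Thm 3.4 (3.9) p.656, (4.5) p.670] -/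
theorem log_gaussNorm_effLaplacianLim (L : ℕ) (M : Fin (d + 1) → ℕ) [∀ μ, NeZero (M μ)] (hLodd : Odd L) (hL : 2 ≤ L) {a m2 : ℝ} (ha : 0 < a) (hm : 0 < m2) :
    Real.log (gaussNorm (Matrix.of fun b b' => effLaplacianLim L M a m2 b b'))
      = (Fintype.card (Tor M) : ℝ) / 2 * Real.log (2 * Real.pi) - 1 / 2 * ∑ q : Tor M, Real.log (effSymLim a L m2 (sOf M q)) := by
  have hL1 : (1 : ℝ) < L := by exact_mod_cast (show 1 < L by omega)
  have hγ : 0 < aInf a L / (1 + aInf a L * ((Real.pi / 2) ^ (2 * (d + 1)) * Real.pi ^ (d + 1) / m2 * (1 + 4 / Real.pi) ^ (d + 1))) := by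
    have := aInf_pos ha hL1
    positivity
  rw [log_gaussNorm_eq (effLaplacianLim_transpose_eq L M a m2) hγ (coercive_effLaplacianLim L M hLodd hL ha hm), log_det_effLaplacianLim L M hLodd hL ha hm]

/-! ## §3 King's (3.93) for the normalisations themselves -/

/-- ★★★ **KING's (3.93) IN THE FREE MODEL — THE RATE OF THE NORMALISATIONS**: for `L` odd `≥ 2`, `a, m² > 0`, `K ≥ 1` and every unit torus,
`|ln N_K − ln N_∞| = ½|ln det Δ^{(K)} − ln det Δ^{(∞)}| ≤ ½|Ω|·((a_∞⁻¹+m⁻²)·C_Δ(a))·L^{−2K}`, `C_Δ(a) = (8∕3)a²(a⁻¹ + π²∕48 + 1∕3) + (4∕3)a` — extensive, rate `η² = L^{−2K}`.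
[cite: King1986, (3.93) p.669, (3.89) p.668, Lemma 4.3 (4.18) p.672] -/
theorem abs_log_gaussNorm_effLaplacian_sub_lim_le (L : ℕ) (M : Fin (d + 1) → ℕ) [∀ μ, NeZero (M μ)] (hLodd : Odd L) (hL : 2 ≤ L) {a m2 : ℝ} (ha : 0 < a)
    (hm : 0 < m2) {K : ℕ} (hK : 1 ≤ K) :
    haveI : NeZero L := ⟨by omega⟩
    |Real.log (gaussNorm (effLaplacian (L ^ K) M (aK a L K) (((L ^ K : ℕ) : ℝ) ^ 2) m2)) - Real.log (gaussNorm (Matrix.of fun b b' => effLaplacianLim L M a m2 b b'))|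
      ≤ 1 / 2 * ((Fintype.card (Tor M) : ℝ) * (((aInf a L)⁻¹ + m2⁻¹) * (8 / 3 * (a ^ 2 * (a⁻¹ + Real.pi ^ 2 / 48 + 1 / 3)) + 4 / 3 * a))
        * ((L : ℝ) ^ (2 * K))⁻¹) := by
  haveI : NeZero L := ⟨by omega⟩
  have hL1 : (1 : ℝ) < L := by exact_mod_cast (show 1 < L by omega)
  have haK := aK_pos ha hL1 hK
  have hγ : 0 < aInf a L / (1 + aInf a L * ((Real.pi / 2) ^ (2 * (d + 1)) * Real.pi ^ (d + 1) / m2 * (1 + 4 / Real.pi) ^ (d + 1))) := by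
    have := aInf_pos ha hL1
    positivity
  rw [log_gaussNorm_eq (effLaplacian_transpose_eq (L ^ K) M _ _ m2) (by positivity : (0 : ℝ) < ((aK a L K)⁻¹ + m2⁻¹)⁻¹)
      (effLaplacian_coercive_of_nonneg (L ^ K) M haK (by positivity) hm),
    log_gaussNorm_eq (effLaplacianLim_transpose_eq L M a m2) hγ (coercive_effLaplacianLim L M hLodd hL ha hm)]
  have h := abs_log_det_effLaplacian_sub_lim_le L M hLodd hL ha hm hK
  rw [show ∀ A B C : ℝ, (A - 1 / 2 * B) - (A - 1 / 2 * C) = -(1 / 2) * (B - C) from fun A B C => by ring, abs_mul, abs_neg,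
    abs_of_pos (by norm_num : (0 : ℝ) < 1 / 2)]
  exact mul_le_mul_of_nonneg_left h (by norm_num)

/-- ★★ **PER SITE**: `| |Ω|⁻¹ln N_K − |Ω|⁻¹ln N_∞ | ≤ ½((a_∞⁻¹+m⁻²)·C_Δ(a))·L^{−2K}`, uniformly in the volume. [cite: King1986, (3.93) p.669, (3.89) p.668] -/
theorem abs_log_gaussNorm_div_card_sub_lim_le (L : ℕ) (M : Fin (d + 1) → ℕ) [∀ μ, NeZero (M μ)] (hLodd : Odd L) (hL : 2 ≤ L) {a m2 : ℝ} (ha : 0 < a)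
    (hm : 0 < m2) {K : ℕ} (hK : 1 ≤ K) :
    haveI : NeZero L := ⟨by omega⟩
    |(Fintype.card (Tor M) : ℝ)⁻¹ * Real.log (gaussNorm (effLaplacian (L ^ K) M (aK a L K) (((L ^ K : ℕ) : ℝ) ^ 2) m2))
        - (Fintype.card (Tor M) : ℝ)⁻¹ * Real.log (gaussNorm (Matrix.of fun b b' => effLaplacianLim L M a m2 b b'))|
      ≤ 1 / 2 * (((aInf a L)⁻¹ + m2⁻¹) * (8 / 3 * (a ^ 2 * (a⁻¹ + Real.pi ^ 2 / 48 + 1 / 3)) + 4 / 3 * a)) * ((L : ℝ) ^ (2 * K))⁻¹ := by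
  haveI : NeZero L := ⟨by omega⟩
  have hcard : (0 : ℝ) < Fintype.card (Tor M) := by exact_mod_cast Fintype.card_pos
  have h := abs_log_gaussNorm_effLaplacian_sub_lim_le L M hLodd hL ha hm hK
  rw [← mul_sub, abs_mul, abs_inv, abs_of_pos hcard, ← div_eq_inv_mul, div_le_iff₀ hcard]
  calc _ ≤ _ := h
    _ = _ := by ring

end King

end Summit.QuantumFields.YangMills.BalabanUVNodes.N15KingModelRung.TorusSpectral

end
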